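/-
HONEST FRAMING: certified error envelopes and provably optimal rounding/accumulation schemes for
low-precision formats under stated cost models; every table by two implementations; no hardware or
vendor claims.
-/
import Summits.Ventures.CertifiedArithmetic.LowPrec.OptChainLabelsRNE

/-!
# The labelled chain law under ROUND-TO-NEAREST-EVEN (OPTIMA.md §B, Theorem T9(f)(ii)), part 2:
# the certified RNE attainment criterion is NECESSARY — strictness for every violating pattern

Part 1 (`OptChainLabelsRNE.lean`) proved that the criterion `RNEGap` (every conversion lossy and
fed by a format at least two bits wider; one bit at a first step) is SUFFICIENT for the constant
`1 + U` of T9(a) to be attained under ANY ties-to-even family of nearest roundings.  This file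
proves the converse, for every start precision, every pattern, every ties-to-even family and ALL
nonnegative grid data: if the pattern violates the criterion then `acc + Σ x_i < (1 + U) · S_n`
STRICTLY whenever `S_n > 0` (`lchain_rne_strict`, `R4_LabelledChainLawRNEConverse_holds`), and
hence the criterion is EXACT (`rne_criterion_iff`): certificate C21's 3451/3451-row observation
is a theorem for every pattern.

THE ARGUMENT.  Equality in T9(a) forces every step to lose exactly `u_π 2^K`, `2^K = ufp(S_n)`
(`step_anatomy`: a step loses at most that much, and losing exactly that much pins its argument
and its result into the binade `[2^K, 2^(K+1))`).  A conversion fed by a format that is NOT wider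
is exact and loses nothing (violation of the first kind).  A conversion to `F(p)` fed by a step
at `F(p+1)` (violation of the second kind) cannot have BOTH steps tight (`not_both_tight`): the
conversion's tight input `m` loses `2^(K-p) > 0`, so `m ∉ F(p)`, so `m` is ODD in `F(p+1)`; the
feeding step's tight input is the midpoint `m + 2^(K-p-1)` of `F(p+1)`, whose other neighbour
`m + 2^(K-p) = fl_p(m) + 2^(K+1-p)` is EVEN in `F(p+1)` — and ties-to-even then forbids the
result `m`.  An induction along the chain (`lchain_deficit_lt`) turns the local slack into
`acc + Σ x_i - S_n < U · 2^K ≤ U · S_n`.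
-/

namespace Summit.Ventures.CertifiedArithmetic.LowPrec.Opt

open Literature.ComputerArithmetic.JeannerodRump2018

/-! ## Anatomy of one rounding step -/

/-- ONE STEP OF A CHAIN (the per-step estimate inside T9(a), with its equality case): a nearest
rounding into `F(p)` of a nonnegative grid number `V`, followed by an admissible chain whose final
value is `< 2^(K+1)`, loses at most `u_p 2^K`; and if it loses EXACTLY `u_p 2^K` then `V` and
`fl V` lie in `[2^K, 2^(K+1))` and `emin + p ≤ K`. -/
theorem step_anatomy {emin : ℤ} {p : ℕ} (hp1 : 1 ≤ p) {fl : ℚ → ℚ}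
    (hfl : IsRoundNearest p emin fl) {V : ℚ} (hV0 : 0 ≤ V) (hVG : IsGrid emin V)
    {ss : List LStep} (hss : ∀ t ∈ ss, t.OK emin) {K : ℤ}
    (hK : lchainEval (fl V) ss < (2 : ℚ) ^ (K + 1)) :
    V - fl V ≤ unitRoundoff p * (2 : ℚ) ^ K ∧
    (V - fl V = unitRoundoff p * (2 : ℚ) ^ K →
      (2 : ℚ) ^ K ≤ V ∧ (2 : ℚ) ^ K ≤ fl V ∧ V < (2 : ℚ) ^ (K + 1) ∧ emin + p ≤ K) := by
  have hu0 : 0 < unitRoundoff p := by unfold unitRoundoff; positivity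
  have hupos : 0 < unitRoundoff p * (2 : ℚ) ^ K := mul_pos hu0 (zpow_pos (by norm_num) _)
  by_cases hsm : V < (2 : ℚ) ^ (emin + p)
  · have hex : fl V = V := fl_eq_self hfl (hVG.isFloat_of_lt hV0 hsm)
    refine ⟨by rw [hex, sub_self]; exact hupos.le, fun ht => ?_⟩
    rw [hex, sub_self] at ht
    exact absurd ht (ne_of_lt hupos)
  · have hbig : (2 : ℚ) ^ (emin + p) ≤ V := not_lt.mp hsm
    have hpos : 0 < V := lt_of_lt_of_le (zpow_pos (by norm_num) _) hbig
    set k := Int.log 2 V with hk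
    have hlow : ((2 : ℕ) : ℚ) ^ k ≤ V := Int.zpow_log_le_self (by norm_num) hpos
    have hup : V < ((2 : ℕ) : ℚ) ^ (k + 1) := Int.lt_zpow_succ_log_self (by norm_num) _
    push_cast at hlow hup
    have hk_ge : emin + p ≤ k + 1 := by
      by_contra hlt
      have : (2 : ℚ) ^ (k + 1) ≤ (2 : ℚ) ^ (emin + (p : ℤ)) :=
        zpow_le_zpow_right₀ (by norm_num) (by omega)
      linarith
    have hKe : emin ≤ K + 1 := by
      have h3 : (2 : ℚ) ^ (emin + (p : ℤ)) ≤ fl V :=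
        le_fl_of_isFloat_le hfl (PTree.isFloat_two_zpow hp1 (by omega)) hbig
      have h4 : (2 : ℚ) ^ (emin + (p : ℤ)) ≤ lchainEval (fl V) ss :=
        zpow_le_lchainEval ss _ hss (by omega) h3
      by_contra hlt
      have h1 : (2 : ℚ) ^ (K + 1) ≤ (2 : ℚ) ^ (emin + (p : ℤ)) :=
        zpow_le_zpow_right₀ (by norm_num) (by omega)
      linarith
    have hlt2 : V < (2 : ℚ) ^ (K + 1) := by
      by_contra hc
      have h5 : (2 : ℚ) ^ (K + 1) ≤ fl V :=
        le_fl_of_isFloat_le hfl (PTree.isFloat_two_zpow hp1 hKe) (not_lt.mp hc)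
      have h6 := zpow_le_lchainEval ss _ hss hKe h5
      linarith
    have hkK : k ≤ K := by
      by_contra hc
      have : (2 : ℚ) ^ (K + 1) ≤ (2 : ℚ) ^ k := zpow_le_zpow_right₀ (by norm_num) (by omega)
      linarith
    have herr := abs_sub_fl_le_half_ulp hp1 hfl hlow hup hk_ge
    have hmono : (2 : ℚ) ^ k ≤ (2 : ℚ) ^ K := zpow_le_zpow_right₀ (by norm_num) hkK
    have hle : V - fl V ≤ unitRoundoff p * (2 : ℚ) ^ k := le_trans (le_abs_self _) herr
    refine ⟨le_trans hle (mul_le_mul_of_nonneg_left hmono (unitRoundoff_nonneg _)), fun ht => ?_⟩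
    have hKk : K ≤ k := by
      by_contra hc
      have hlt' : (2 : ℚ) ^ k < (2 : ℚ) ^ K := zpow_lt_zpow_right₀ (by norm_num) (by omega)
      have : unitRoundoff p * (2 : ℚ) ^ k < unitRoundoff p * (2 : ℚ) ^ K :=
        mul_lt_mul_of_pos_left hlt' hu0
      linarith
    have hkeq : k = K := le_antisymm hkK hKk
    have hKV : (2 : ℚ) ^ K ≤ V := by rw [← hkeq]; exact hlow
    have hKfl : (2 : ℚ) ^ K ≤ fl V :=
      le_fl_of_isFloat_le hfl (PTree.isFloat_two_zpow hp1 (by omega)) hKV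
    have hepK : emin + p ≤ K := by
      by_contra hc
      have heq : emin + (p : ℤ) = K + 1 := by omega
      rw [heq] at hbig
      linarith
    exact ⟨hKV, hKfl, hlt2, hepK⟩

/-! ## Two consecutive tight steps one bit apart contradict ties-to-even -/

/-- THE PARITY OBSTRUCTION: a step into `F(p+1)` whose (ties-to-even) rounding loses exactly
`u_{p+1} 2^K`, immediately followed by a conversion into `F(p)` losing exactly `u_p 2^K` with
result in `[2^K, 2^(K+1))`, is impossible.  (`m = fl_{p+1} V` is odd in `F(p+1)` because the
conversion moves it; `V` is the midpoint between `m` and the even float `fl_p m + 2^(K+1-p)`.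
Only the ties-to-even rule of the first map is used, not even that it rounds to nearest.) -/
theorem not_both_tight {emin K : ℤ} {p : ℕ} (hp : 1 ≤ p) {flq flp : ℚ → ℚ}
    (hte : TiesToEven (p + 1) emin flq) (hflp : IsRoundNearest p emin flp) {V : ℚ}
    (htq : V - flq V = unitRoundoff (p + 1) * (2 : ℚ) ^ K)
    (htp : flq V - flp (flq V) = unitRoundoff p * (2 : ℚ) ^ K)
    (hKw : (2 : ℚ) ^ K ≤ flp (flq V)) (hwlt : flp (flq V) < (2 : ℚ) ^ (K + 1))
    (heK : emin + p ≤ K) : False := by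
  set m := flq V with hm
  set w := flp m with hw
  have h2 : (2 : ℚ) ≠ 0 := by norm_num
  have hup : unitRoundoff p * (2 : ℚ) ^ K = (2 : ℚ) ^ (K - p) := by
    rw [mul_comm, two_zpow_mul_unitRoundoff]
  have huq : unitRoundoff (p + 1) * (2 : ℚ) ^ K = (2 : ℚ) ^ (K - p - 1) := by
    rw [mul_comm, two_zpow_mul_unitRoundoff]; congr 1; push_cast; ring
  rw [hup] at htp
  rw [huq] at htq
  have hd1 : (2 : ℚ) ^ (K + 1 - p) = 2 * (2 : ℚ) ^ (K - p) := by
    rw [show K + 1 - (p : ℤ) = (K - p) + 1 by ring, zpow_add_one₀ h2, mul_comm]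
  have hd2 : (2 : ℚ) ^ (K - p) = 2 * (2 : ℚ) ^ (K - p - 1) := by
    rw [mul_comm, ← zpow_add_one₀ h2]; congr 1; ring
  have hpos1 : (0 : ℚ) < (2 : ℚ) ^ (K - p - 1) := zpow_pos (by norm_num) _
  have hpos0 : (0 : ℚ) < (2 : ℚ) ^ (K - p) := zpow_pos (by norm_num) _
  have hKpos : (0 : ℚ) < (2 : ℚ) ^ (K + 1 - p) := zpow_pos (by norm_num) _
  -- `w = k · 2^(K+1-p)` with `0 < k < 2^p`
  have hwF : IsFloat p emin w := (hflp m).1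
  obtain ⟨k, hk⟩ := IsFloat.exists_int_mul_zpow hwF hKw
  have hk_lt : k < (2 : ℤ) ^ p := by
    have h1 : (k : ℚ) * (2 : ℚ) ^ (K + 1 - p) < (2 : ℚ) ^ (p : ℤ) * (2 : ℚ) ^ (K + 1 - p) := by
      rw [← zpow_add₀ h2, show (p : ℤ) + (K + 1 - p) = K + 1 by ring, ← hk]; exact hwlt
    have h3 : (k : ℚ) < (2 : ℚ) ^ (p : ℤ) := lt_of_mul_lt_mul_right h1 hKpos.le
    rw [zpow_natCast] at h3
    exact_mod_cast h3
  have hk_pos : 0 < k := by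
    have h1 : (0 : ℚ) * (2 : ℚ) ^ (K + 1 - p) < (k : ℚ) * (2 : ℚ) ^ (K + 1 - p) := by
      rw [zero_mul, ← hk]; exact lt_of_lt_of_le (zpow_pos (by norm_num) _) hKw
    have h3 : (0 : ℚ) < k := lt_of_mul_lt_mul_right h1 hKpos.le
    exact_mod_cast h3
  -- the even competitor `f = w + 2^(K+1-p)`
  set f := w + (2 : ℚ) ^ (K + 1 - p) with hf
  have hfE : IsFloat p (emin + 1) f := by
    by_cases hk1 : k + 1 < (2 : ℤ) ^ p
    · refine ⟨k + 1, K + 1 - p, ?_, by omega, ?_⟩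
      · rw [abs_of_pos (by omega)]; exact hk1
      · rw [hf, hk]; push_cast; ring
    · have hkeq : ((k + 1 : ℤ) : ℚ) = (2 : ℚ) ^ (p : ℤ) := by
        rw [zpow_natCast]; exact_mod_cast (show k + 1 = (2 : ℤ) ^ p by omega)
      have hf2 : f = (2 : ℚ) ^ (K + 1) := by
        have : f = ((k + 1 : ℤ) : ℚ) * (2 : ℚ) ^ (K + 1 - p) := by rw [hf, hk]; push_cast; ring
        rw [this, hkeq, ← zpow_add₀ h2]; congr 1; ring
      rw [hf2]; exact PTree.isFloat_two_zpow hp (by omega)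
  have hf_even : IsEvenFloat (p + 1) emin f := by
    show IsFloat (p + 1 - 1) (emin + 1) f
    rw [Nat.add_sub_cancel]; exact hfE
  -- `m` is not even in `F(p+1)`: otherwise `m ∈ F(p)` and the conversion would be exact
  have hm_odd : ¬ IsEvenFloat (p + 1) emin m := by
    intro h
    have h' : IsFloat (p + 1 - 1) (emin + 1) m := h
    rw [Nat.add_sub_cancel] at h'
    obtain ⟨M, e, hM, he, hMe⟩ := h'
    have hmF : IsFloat p emin m := ⟨M, e, hM, by omega, hMe⟩
    have hwm : w = m := fl_eq_self hflp hmF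
    rw [hwm, sub_self] at htp
    linarith
  -- `V` is the midpoint between `m` and `f`
  have hne : f ≠ m := by
    have : f = m + (2 : ℚ) ^ (K - p) := by rw [hf, hd1]; linarith
    rw [this]; linarith
  have hdist : |V - f| ≤ |V - m| := by
    have hVm : V - m = (2 : ℚ) ^ (K - p - 1) := htq
    have hVf : V - f = -((2 : ℚ) ^ (K - p - 1)) := by rw [hf, hd1]; linarith
    rw [hVm, hVf, abs_neg, abs_of_pos hpos1]
  exact hm_odd (hte V f hf_even hne hdist)

/-! ## Violations of the criterion and the strict deficit bound -/

/-- The add/convert pattern of a step: (precision, is it a conversion). -/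
def lpat (s : LStep) : ℕ × Bool := (s.prec, decide (s.x = 0))

/-- The chain starts with a conversion into a format exactly ONE bit narrower than `q`. -/
def HeadGap1 (q : ℕ) : List LStep → Prop
  | [] => False
  | s' :: _ => s'.x = 0 ∧ q = s'.prec + 1

/-- A VIOLATION of the RNE criterion somewhere in the chain, entered from precision `e`: some
conversion is fed by a format that is not wider (first kind), or some conversion is fed by the
STEP just before it at a format exactly one bit wider (second kind). -/
def Viol : ℕ → List LStep → Prop
  | _, [] => False
  | e, s :: rest => (s.x = 0 ∧ e ≤ s.prec) ∨ HeadGap1 s.prec rest ∨ Viol s.prec rest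

/-- Failing `RNEGap` means a violation (for the non-first flag, possibly a one-bit conversion at
the very head, which the caller owns). -/
theorem viol_of_not_RNEGap : ∀ (ss : List LStep) (e : ℕ) (first : Bool),
    ¬ RNEGap e first (ss.map lpat) → Viol e ss ∨ (first = false ∧ HeadGap1 e ss)
  | [], e, first, h => by simp [RNEGap] at h
  | s :: rest, e, first, h => by
      by_cases hx : s.x = 0
      · have hm : (s :: rest).map lpat = (s.prec, true) :: rest.map lpat := by simp [lpat, hx]
        rw [hm] at h
        simp only [RNEGap] at h
        by_cases h1 : e ≤ s.prec
        · exact Or.inl (Or.inl ⟨hx, h1⟩)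
        by_cases h3 : RNEGap s.prec false (rest.map lpat)
        · have hmid : ¬ (first = true ∨ s.prec + 2 ≤ e) := fun hm' => h ⟨by omega, hm', h3⟩
          have hfst : first = false := by
            cases first
            · rfl
            · exact absurd (Or.inl rfl) hmid
          have he : e = s.prec + 1 := by
            have : ¬ s.prec + 2 ≤ e := fun h' => hmid (Or.inr h')
            omega
          refine Or.inr ⟨hfst, ?_⟩
          simp only [HeadGap1]
          exact ⟨hx, he⟩
        · rcases viol_of_not_RNEGap rest s.prec false h3 with hv | ⟨-, hg⟩
          · exact Or.inl (Or.inr (Or.inr hv))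
          · exact Or.inl (Or.inr (Or.inl hg))
      · have hm : (s :: rest).map lpat = (s.prec, false) :: rest.map lpat := by simp [lpat, hx]
        rw [hm] at h
        simp only [RNEGap] at h
        rcases viol_of_not_RNEGap rest s.prec false h with hv | ⟨-, hg⟩
        · exact Or.inl (Or.inr (Or.inr hv))
        · exact Or.inl (Or.inr (Or.inl hg))

/-- THE STRICT DEFICIT BOUND: along an admissible chain of ties-to-even nearest roundings entered
from a float of `F(e)`, with final value `< 2^(K+1)`, a violation makes the total loss STRICTLY
less than `U · 2^K`. -/
theorem lchain_deficit_lt {emin : ℤ} :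
    ∀ (ss : List LStep) (acc : ℚ) (e : ℕ), 0 ≤ acc → IsFloat e emin acc →
      (∀ s ∈ ss, s.OK emin ∧ TiesToEven s.prec emin s.fl) →
      ∀ K : ℤ, lchainEval acc ss < (2 : ℚ) ^ (K + 1) → Viol e ss →
        acc + xsum ss - lchainEval acc ss < usum ss * (2 : ℚ) ^ K
  | [], _, _, _, _, _, _, _, hv => by simp [Viol] at hv
  | s :: rest, acc, e, hacc0, haccF, hss, K, hK, hv => by
      obtain ⟨⟨hp1, hfl, hx0, hxG⟩, hte⟩ := hss s (by simp)
      have hrest : ∀ t ∈ rest, t.OK emin ∧ TiesToEven t.prec emin t.fl :=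
        fun t ht => hss t (by simp [ht])
      have hrestOK : ∀ t ∈ rest, t.OK emin := fun t ht => (hrest t ht).1
      rw [lchainEval_cons] at hK ⊢
      have hV0 : 0 ≤ acc + s.x := by linarith
      have hVG : IsGrid emin (acc + s.x) := (isGrid_of_isFloat haccF).add hxG
      have hmF : IsFloat s.prec emin (s.fl (acc + s.x)) := (hfl _).1
      have hm0 : 0 ≤ s.fl (acc + s.x) := le_fl_of_isFloat_le hfl (isFloat_zero _ _) hV0
      have anat := step_anatomy hp1 hfl hV0 hVG hrestOK hK
      have hupos : 0 < unitRoundoff s.prec * (2 : ℚ) ^ K :=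
        mul_pos (by unfold unitRoundoff; positivity) (zpow_pos (by norm_num) _)
      simp only [Viol] at hv
      rcases hv with ⟨hx, hep⟩ | hgap | hv'
      · -- first kind: the conversion is exact
        have hVF : IsFloat s.prec emin (acc + s.x) := by
          rw [hx, add_zero]; exact PTree.isFloat_mono hep haccF
        have hmV : s.fl (acc + s.x) = acc + s.x := fl_eq_self hfl hVF
        have htail := lchain_deficit_le rest _ hm0 (isGrid_of_isFloat hmF) hrestOK K hK
        rw [xsum_cons, usum_cons, add_mul]
        rw [hmV] at htail ⊢
        linarith
      · -- second kind: the next step is a conversion one bit narrower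
        cases rest with
        | nil => simp [HeadGap1] at hgap
        | cons s' rest' =>
          simp only [HeadGap1] at hgap
          obtain ⟨hx', hq⟩ := hgap
          obtain ⟨⟨hp1', hfl', hx0', hxG'⟩, -⟩ := hrest s' (by simp)
          have hrest'OK : ∀ t ∈ rest', t.OK emin := fun t ht => hrestOK t (by simp [ht])
          rw [lchainEval_cons] at hK ⊢
          set m := s.fl (acc + s.x) with hm
          have hV'0 : 0 ≤ m + s'.x := by linarith
          have hV'G : IsGrid emin (m + s'.x) := (isGrid_of_isFloat hmF).add hxG'
          have hwF : IsFloat s'.prec emin (s'.fl (m + s'.x)) := (hfl' _).1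
          have hw0 : 0 ≤ s'.fl (m + s'.x) := le_fl_of_isFloat_le hfl' (isFloat_zero _ _) hV'0
          have anat' := step_anatomy hp1' hfl' hV'0 hV'G hrest'OK hK
          have htail := lchain_deficit_le rest' _ hw0 (isGrid_of_isFloat hwF) hrest'OK K hK
          have hupos' : 0 < unitRoundoff s'.prec * (2 : ℚ) ^ K :=
            mul_pos (by unfold unitRoundoff; positivity) (zpow_pos (by norm_num) _)
          have key : ¬ (acc + s.x - m = unitRoundoff s.prec * (2 : ℚ) ^ K ∧
              m + s'.x - s'.fl (m + s'.x) = unitRoundoff s'.prec * (2 : ℚ) ^ K) := by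
            rintro ⟨ht1, ht2⟩
            obtain ⟨hKV', hKw, hV'lt, heK⟩ := anat'.2 ht2
            rw [hx', add_zero] at ht2 hKw hV'lt hKV'
            have hwlt : s'.fl m < (2 : ℚ) ^ (K + 1) := by linarith
            have hteq : TiesToEven (s'.prec + 1) emin s.fl := by rw [← hq]; exact hte
            have ht1' : acc + s.x - m = unitRoundoff (s'.prec + 1) * (2 : ℚ) ^ K := by
              rw [← hq]; exact ht1
            exact not_both_tight hp1' hteq hfl' ht1' ht2 hKw hwlt heK
          rw [xsum_cons, xsum_cons, usum_cons, usum_cons, add_mul, add_mul]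
          rcases anat.1.lt_or_eq with hlt1 | heq1
          · linarith [anat'.1]
          · have hlt2 : m + s'.x - s'.fl (m + s'.x) < unitRoundoff s'.prec * (2 : ℚ) ^ K :=
              lt_of_le_of_ne anat'.1 (fun h => key ⟨heq1, h⟩)
            linarith
      · -- violation further down the chain
        have ih := lchain_deficit_lt rest _ s.prec hm0 hmF hrest K hK hv'
        rw [xsum_cons, usum_cons, add_mul]
        linarith [anat.1]

/-- STRICTNESS UNDER A VIOLATION: `acc + Σ x_i < (1 + U) · S_n` whenever `S_n > 0`. -/
theorem exact_lt_lchain_of_viol {emin : ℤ} {e : ℕ} (ss : List LStep) (acc : ℚ)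
    (hacc0 : 0 ≤ acc) (haccF : IsFloat e emin acc)
    (hss : ∀ s ∈ ss, s.OK emin ∧ TiesToEven s.prec emin s.fl) (hv : Viol e ss)
    (hpos : 0 < lchainEval acc ss) :
    acc + xsum ss < (1 + usum ss) * lchainEval acc ss := by
  set c := lchainEval acc ss with hc
  set K := Int.log 2 c with hK
  have hlow : ((2 : ℕ) : ℚ) ^ K ≤ c := Int.zpow_log_le_self (by norm_num) hpos
  have hupK : c < ((2 : ℕ) : ℚ) ^ (K + 1) := Int.lt_zpow_succ_log_self (by norm_num) _
  push_cast at hlow hupK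
  have hdef := lchain_deficit_lt ss acc e hacc0 haccF hss K hupK hv
  have hmono : usum ss * (2 : ℚ) ^ K ≤ usum ss * c :=
    mul_le_mul_of_nonneg_left hlow (usum_nonneg ss)
  have : (1 + usum ss) * c = c + usum ss * c := by ring
  linarith

/-- THE RNE CRITERION IS NECESSARY (Theorem T9(f)(ii), "only if"): for EVERY start precision
`e₀`, every start value `acc ∈ F(e₀)`, `acc ≥ 0`, every admissible chain (nonnegative grid data)
of nearest roundings that resolve ties to even, if the chain's add/convert pattern violates
`RNEGap e₀` then `acc + Σ x_i < (1 + Σ u_{π_i}) · S_n` as soon as `S_n > 0`. -/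
theorem lchain_rne_strict {emin : ℤ} {e₀ : ℕ} (ss : List LStep) (acc : ℚ)
    (hacc0 : 0 ≤ acc) (haccF : IsFloat e₀ emin acc)
    (hss : ∀ s ∈ ss, s.OK emin ∧ TiesToEven s.prec emin s.fl)
    (hviol : ¬ RNEGap e₀ true (ss.map lpat)) (hpos : 0 < lchainEval acc ss) :
    acc + xsum ss < (1 + usum ss) * lchainEval acc ss := by
  rcases viol_of_not_RNEGap ss e₀ true hviol with hv | ⟨h, -⟩
  · exact exact_lt_lchain_of_viol ss acc hacc0 haccF hss hv hpos
  · simp at h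

/-! ## Registered form and the exact criterion -/

/-- LABELLED CHAIN LAW UNDER ROUND-TO-NEAREST-EVEN, NECESSITY (OPTIMA.md §B, T9(f)(ii)):
whenever the add/convert pattern of an admissible chain of ties-to-even nearest roundings,
entered from `acc ∈ F(e₀)`, violates the criterion `RNEGap e₀`, the bound of T9(a) is STRICT:
`acc + Σ x_i < (1 + Σ u_{π_i}) · S_n` (`S_n > 0`; all nonnegative grid data). -/
def R4_LabelledChainLawRNEConverse : Prop :=
  ∀ (emin : ℤ) (e₀ : ℕ) (acc : ℚ) (ss : List LStep), 0 ≤ acc → IsFloat e₀ emin acc →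
    (∀ s ∈ ss, s.OK emin ∧ TiesToEven s.prec emin s.fl) →
    ¬ RNEGap e₀ true (ss.map fun s => (s.prec, decide (s.x = 0))) →
    0 < lchainEval acc ss → acc + xsum ss < (1 + usum ss) * lchainEval acc ss

/-- `R4_LabelledChainLawRNEConverse` holds. -/
theorem R4_LabelledChainLawRNEConverse_holds : R4_LabelledChainLawRNEConverse :=
  fun _ _ acc ss hacc0 haccF hss hviol hpos => lchain_rne_strict ss acc hacc0 haccF hss hviol hpos

/-- THE RNE CRITERION IS EXACT (T9(f)(ii) in full, for every pattern): for a start precision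
`e₀ ≥ 2` and an add/convert pattern `P` with precisions `≥ 2` (and exponent room), `RNEGap e₀ P`
holds IF AND ONLY IF some ties-to-even family of nearest roundings and some nonnegative data with
`acc ∈ F(e₀)` realise `P` with `S_n > 0` and `acc + Σ x_i = (1 + Σ u_{π_i}) · S_n` — and then
(part 1) EVERY ties-to-even family does. -/
theorem rne_criterion_iff {emin E : ℤ} {e₀ : ℕ} (he₀ : 2 ≤ e₀) (he₀E : emin + e₀ ≤ E)
    (P : List (ℕ × Bool)) (hP : ∀ q ∈ P, 2 ≤ q.1 ∧ emin + q.1 ≤ E) :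
    RNEGap e₀ true P ↔
      ∃ fl : ℕ → ℚ → ℚ, (∀ π, IsRoundNearest π emin (fl π) ∧ TiesToEven π emin (fl π)) ∧
        ∃ (acc : ℚ) (ws : List LStep), ws.map lpat = P ∧ (∀ s ∈ ws, s.fl = fl s.prec) ∧
          0 ≤ acc ∧ IsFloat e₀ emin acc ∧ (∀ s ∈ ws, s.OK emin) ∧ 0 < lchainEval acc ws ∧
          acc + xsum ws = (1 + usum ws) * lchainEval acc ws := by
  constructor
  · intro hgap
    obtain ⟨fl, hfl⟩ := exists_tiesToEven_family emin
    obtain ⟨hacc, hok, hev, heq⟩ := lchain_rne_attained hfl he₀ he₀E P hP hgap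
    refine ⟨fl, hfl, _, witSteps fl E P, map_witSteps fl E P, fl_witSteps fl E P, ?_, hacc, hok,
      ?_, heq⟩
    · exact mul_nonneg (zpow_nonneg (by norm_num) _) (by linarith [Rsum_nonneg e₀ P])
    · rw [hev]; exact zpow_pos (by norm_num) _
  · rintro ⟨fl, hfl, acc, ws, hmap, hfam, hacc0, haccF, hok, hpos, heq⟩
    by_contra hv
    have hss : ∀ s ∈ ws, s.OK emin ∧ TiesToEven s.prec emin s.fl :=
      fun s hs => ⟨hok s hs, by rw [hfam s hs]; exact (hfl s.prec).2⟩
    have hlt := lchain_rne_strict ws acc hacc0 haccF hss (by rw [hmap]; exact hv) hpos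
    linarith

/-- C21 row 'S0:F4 | add4 conv3' (criterion fails: the conversion is fed by a format only one
bit wider): by `lchain_rne_strict`, `D_RNE < 1 + U = 19/16` for all data — C21 reports
`D_RNE = 151/128`. -/
example : ¬ RNEGap 4 true [(4, false), (3, true)] := by simp [RNEGap]

end Summit.Ventures.CertifiedArithmetic.LowPrec.Opt
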